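import Summits.PneNP.PneNP.Theorems.KarlinRubinMonotoneBlindSwitchCount
import Summits.PneNP.PneNP.Theorems.KarlinRubinMonotoneBlindDnfBounds

/-!
# Route KarlinRubin, crux `MonotoneBlind` (stmt-PneNP-18027): the clique-restriction switching lemma

Fourth file of the line (seat write-up `MonotoneBlind_AC0_announce.md`): the switching lemma assembled, for clause
lists whose clauses have `≤ L` slots (wide clauses are removed beforehand by the consumer), with `r := C(v₀-1, 2)`.

* `switch_vertexBad_card_le` — the `n₁`-subsets `V₁ ⊆ V` meeting the vertex set of some clause in `≥ v₀` vertices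
  number at most `|l| · C(2L, v₀) · C(#V - v₀, n₁ - v₀)`;
* `switch_bad_count` — **the switching lemma, counting form**: summed over `V₁`, the inputs `x` for which some inside
  assignment has a canonical run querying slots that meet `≥ v₀` vertices number at most
  `2^{#slots} · C(#V - v₀, n₁ - v₀) · (2^{2r} (2(L+1)^{2r})^{r+1} + |l| · C(2L, v₀))`
  (to be compared with `2^{#slots} · C(#V, n₁)`: the ratio `C(#V-v₀, n₁-v₀)/C(#V, n₁) ≤ (n₁/#V)^{v₀}` is the gain);
* `switch_dnf_of_good` — on the complement (every run meets `< v₀` vertices), the restricted CNF equals, on all inputs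
  agreeing with `x` off the inside of `V₁`, an `r`-DNF with `≤ (#slots+1)^r` terms inside `V₁`;
* `switch_cnf_of_good` — the dual statement for monotone DNFs (read through the complemented input), and
  `switch_bad_count_compl` — complementing the input does not change the count.

All `--supports stmt-PneNP-18027`; no new definitions.
-/

set_option linter.dupNamespace false -- `Summit.PneNP.PneNP.…`: summit = sub-problem (D-0017)

namespace Summit.PneNP.PneNP.Theorems

open Finset
open Literature.Computability.Complexity
open Literature.Probability.RandomGraphs.PlantedClique

variable {n : ℕ}

/-! ### The vertex-structure event -/

/-- **Sub-universes meeting a clause in many vertices.** If every clause of `l` has `≤ L` slots, the `n₁`-subsets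
`V₁ ⊆ V` such that some clause has `≥ v₀` of its vertices in `V₁` number at most `|l| · C(2L, v₀) · C(#V - v₀, n₁ - v₀)`.
[folklore] -/
theorem switch_vertexBad_card_le (V : Finset (Fin n)) (n₁ L v₀ : ℕ) (l : List (Finset (⊤ : SimpleGraph (Fin n)).edgeSet))
    (hl : ∀ S ∈ l, #S ≤ L) :
    #((powersetCard n₁ V).filter fun V₁ => ∃ S ∈ l,
        v₀ ≤ #((univ.filter fun v : Fin n => ∃ e ∈ S, v ∈ (e : Sym2 (Fin n))) ∩ V₁)) ≤
      l.length * ((2 * L).choose v₀ * (#V - v₀).choose (n₁ - v₀)) := by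
  classical
  -- one clause
  have hone : ∀ S ∈ l, #((powersetCard n₁ V).filter fun V₁ =>
      v₀ ≤ #((univ.filter fun v : Fin n => ∃ e ∈ S, v ∈ (e : Sym2 (Fin n))) ∩ V₁)) ≤
      (2 * L).choose v₀ * (#V - v₀).choose (n₁ - v₀) := by
    intro S hS
    set VS := univ.filter fun v : Fin n => ∃ e ∈ S, v ∈ (e : Sym2 (Fin n)) with hVS
    have hVScard : #VS ≤ 2 * L := (card_vertices_le_two_mul_card S).trans (Nat.mul_le_mul_left 2 (hl S hS))
    calc #((powersetCard n₁ V).filter fun V₁ => v₀ ≤ #(VS ∩ V₁))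
        ≤ #((powersetCard v₀ VS).biUnion fun W => (powersetCard n₁ V).filter fun V₁ => W ⊆ V₁) := by
          refine card_le_card fun V₁ hV₁ => ?_
          rw [mem_filter] at hV₁
          obtain ⟨W, hW, hWcard⟩ := exists_subset_card_eq hV₁.2
          rw [mem_biUnion]
          refine ⟨W, mem_powersetCard.2 ⟨hW.trans inter_subset_left, hWcard⟩, mem_filter.2 ⟨hV₁.1, ?_⟩⟩
          exact hW.trans inter_subset_right
      _ ≤ ∑ W ∈ powersetCard v₀ VS, #((powersetCard n₁ V).filter fun V₁ => W ⊆ V₁) := card_biUnion_le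
      _ ≤ ∑ W ∈ powersetCard v₀ VS, (#V - v₀).choose (n₁ - v₀) := by
          refine sum_le_sum fun W hW => ?_
          rw [mem_powersetCard] at hW
          exact switch_card_supersets_le V n₁ v₀ W hW.2.ge
      _ = (#VS).choose v₀ * (#V - v₀).choose (n₁ - v₀) := by rw [sum_const, smul_eq_mul, card_powersetCard]
      _ ≤ (2 * L).choose v₀ * (#V - v₀).choose (n₁ - v₀) :=
          Nat.mul_le_mul_right _ (Nat.choose_le_choose v₀ hVScard)
  -- union over the clauses
  induction l with
  | nil => simp
  | cons S l ih =>
    have hl' : ∀ T ∈ l, #T ≤ L := fun T hT => hl T (List.mem_cons_of_mem _ hT)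
    have hsplit : ((powersetCard n₁ V).filter fun V₁ => ∃ T ∈ S :: l,
        v₀ ≤ #((univ.filter fun v : Fin n => ∃ e ∈ T, v ∈ (e : Sym2 (Fin n))) ∩ V₁)) ⊆
        ((powersetCard n₁ V).filter fun V₁ =>
          v₀ ≤ #((univ.filter fun v : Fin n => ∃ e ∈ S, v ∈ (e : Sym2 (Fin n))) ∩ V₁)) ∪
        ((powersetCard n₁ V).filter fun V₁ => ∃ T ∈ l,
          v₀ ≤ #((univ.filter fun v : Fin n => ∃ e ∈ T, v ∈ (e : Sym2 (Fin n))) ∩ V₁)) := by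
      intro V₁ hV₁
      rw [mem_filter] at hV₁
      obtain ⟨hV₁, T, hT, hTv⟩ := hV₁
      rw [mem_union, mem_filter, mem_filter]
      rcases List.mem_cons.1 hT with rfl | hT
      · exact Or.inl ⟨hV₁, hTv⟩
      · exact Or.inr ⟨hV₁, T, hT, hTv⟩
    calc _ ≤ _ := card_le_card hsplit
      _ ≤ _ := card_union_le _ _
      _ ≤ (2 * L).choose v₀ * (#V - v₀).choose (n₁ - v₀) +
            l.length * ((2 * L).choose v₀ * (#V - v₀).choose (n₁ - v₀)) :=
          add_le_add (hone S List.mem_cons_self) (ih hl' fun T hT => hone T (List.mem_cons_of_mem _ hT))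
      _ = (S :: l).length * ((2 * L).choose v₀ * (#V - v₀).choose (n₁ - v₀)) := by
          rw [List.length_cons]; ring

/-! ### The switching lemma, counting form -/

open Classical in
/-- **Clique-restriction switching lemma (counting form).** For a clause list `l` with clauses of `≤ L` slots,
`0 < v₀` and `r = C(v₀-1,2)`: summed over the `n₁`-subsets `V₁ ⊆ V`, the inputs for which some inside assignment has a
canonical run whose queried slots meet `≥ v₀` vertices number at most
`2^{#slots} · C(#V - v₀, n₁ - v₀) · (2^{2r} (2(L+1)^{2r})^{r+1} + |l| · C(2L, v₀))`. [cite: Beame1994, §3] -/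
theorem switch_bad_count (V : Finset (Fin n)) (n₁ L v₀ : ℕ) (hv₀ : 0 < v₀)
    (l : List (Finset (⊤ : SimpleGraph (Fin n)).edgeSet)) (hl : ∀ S ∈ l, #S ≤ L) :
    ∑ V₁ ∈ powersetCard n₁ V, #(univ.filter fun x : EdgeVec n =>
        ∃ z : EdgeVec n, v₀ ≤ #(univ.filter fun v : Fin n =>
          ∃ e ∈ (swRun V₁ x z l ∅).2, v ∈ (e : Sym2 (Fin n)))) ≤
      2 ^ Fintype.card (⊤ : SimpleGraph (Fin n)).edgeSet * (#V - v₀).choose (n₁ - v₀) *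
        (2 ^ ((v₀ - 1).choose 2 + (v₀ - 1).choose 2) *
            (2 * (L + 1) ^ (2 * (v₀ - 1).choose 2)) ^ ((v₀ - 1).choose 2 + 1) +
          l.length * (2 * L).choose v₀) := by
  set r := (v₀ - 1).choose 2 with hr
  set N := Fintype.card (⊤ : SimpleGraph (Fin n)).edgeSet with hN
  -- split by the structure condition
  set badRun : Finset (Fin n) → Finset (EdgeVec n) := fun V₁ => univ.filter fun x : EdgeVec n =>
      ∃ z : EdgeVec n, v₀ ≤ #(univ.filter fun v : Fin n =>
        ∃ e ∈ (swRun V₁ x z l ∅).2, v ∈ (e : Sym2 (Fin n))) with hbadRun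
  set str : Finset (Fin n) → EdgeVec n → Prop := fun V₁ x =>
      ∀ S ∈ l, (∀ e ∈ S, (¬ ∀ v ∈ (e : Sym2 (Fin n)), v ∈ V₁) → x e = false) →
        #S ≤ L ∧ #(S.filter fun e : (⊤ : SimpleGraph (Fin n)).edgeSet => ∀ v ∈ (e : Sym2 (Fin n)), v ∈ V₁) ≤ r
    with hstr
  set vbad := (powersetCard n₁ V).filter fun V₁ => ∃ S ∈ l,
      v₀ ≤ #((univ.filter fun v : Fin n => ∃ e ∈ S, v ∈ (e : Sym2 (Fin n))) ∩ V₁) with hvbad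
  -- off the vertex-bad sub-universes the structure condition holds for every input
  have hstr_of : ∀ V₁ ∈ powersetCard n₁ V, V₁ ∉ vbad → ∀ x, str V₁ x := by
    intro V₁ hV₁ hnot x S hS _
    refine ⟨hl S hS, ?_⟩
    refine (card_filter_inside_le_choose V₁ S).trans ?_
    rw [hr]
    refine Nat.choose_le_choose 2 ?_
    have hlt : #((univ.filter fun v : Fin n => ∃ e ∈ S, v ∈ (e : Sym2 (Fin n))) ∩ V₁) < v₀ := by
      by_contra hge
      exact hnot (mem_filter.2 ⟨hV₁, S, hS, not_lt.1 hge⟩)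
    rw [inter_comm] at hlt
    omega
  have hsplit : ∀ V₁ ∈ powersetCard n₁ V, #(badRun V₁) ≤
      #(univ.filter fun x : EdgeVec n => x ∈ badRun V₁ ∧ str V₁ x) + (if V₁ ∈ vbad then 2 ^ N else 0) := by
    intro V₁ hV₁
    by_cases hvb : V₁ ∈ vbad
    · rw [if_pos hvb]
      refine le_add_left ((card_le_univ _).trans ?_)
      simp [hN, EdgeVec]
    · rw [if_neg hvb, add_zero]
      refine card_le_card fun x hx => mem_filter.2 ⟨mem_univ _, hx, hstr_of V₁ hV₁ hvb x⟩
  have hmain := switch_count V n₁ l L r v₀ hv₀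
  calc ∑ V₁ ∈ powersetCard n₁ V, #(badRun V₁)
      ≤ ∑ V₁ ∈ powersetCard n₁ V, (#(univ.filter fun x : EdgeVec n => x ∈ badRun V₁ ∧ str V₁ x) +
          (if V₁ ∈ vbad then 2 ^ N else 0)) := sum_le_sum hsplit
    _ = ∑ V₁ ∈ powersetCard n₁ V, #(univ.filter fun x : EdgeVec n => x ∈ badRun V₁ ∧ str V₁ x) +
          #vbad * 2 ^ N := by
        have hvb : ∑ V₁ ∈ powersetCard n₁ V, (if V₁ ∈ vbad then 2 ^ N else 0) = #vbad * 2 ^ N := by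
          rw [← sum_filter, sum_const, smul_eq_mul, filter_mem_eq_inter,
            inter_eq_right.2 (by rw [hvbad]; exact filter_subset _ _)]
        rw [sum_add_distrib, hvb]
    _ ≤ 2 ^ (r + r) * (2 * (L + 1) ^ (2 * r)) ^ (r + 1) * 2 ^ N * (#V - v₀).choose (n₁ - v₀) +
          l.length * ((2 * L).choose v₀ * (#V - v₀).choose (n₁ - v₀)) * 2 ^ N := by
        refine add_le_add (le_trans (sum_le_sum fun V₁ _ => le_of_eq ?_) hmain)
          (Nat.mul_le_mul_right _ (switch_vertexBad_card_le V n₁ L v₀ l hl))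
        congr 1
        ext x
        simp only [hbadRun, hstr, mem_filter, mem_univ, true_and]
    _ = _ := by rw [hr, hN]; ring

/-! ### The good event: the restricted CNF is a narrow DNF -/

open Classical in
/-- **On the good event the restricted CNF is an `r`-DNF.** If every canonical run under `(V₁, x)` queries slots
meeting `< v₀` vertices, there is a family `𝓣` of `≤ (#slots+1)^r` terms, each of `≤ r = C(v₀-1,2)` slots inside `V₁`,
such that on every input agreeing with `x` off the inside of `V₁` the CNF of `l` holds iff some term of `𝓣` is on.
[cite: Beame1994, §3] -/
theorem switch_dnf_of_good (V₁ : Finset (Fin n)) (x : EdgeVec n) (l : List (Finset (⊤ : SimpleGraph (Fin n)).edgeSet))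
    (v₀ : ℕ) (hgood : ∀ z : EdgeVec n, #(univ.filter fun v : Fin n =>
      ∃ e ∈ (swRun V₁ x z l ∅).2, v ∈ (e : Sym2 (Fin n))) < v₀) :
    ∃ 𝓣 : Finset (Finset (⊤ : SimpleGraph (Fin n)).edgeSet),
      #𝓣 ≤ (Fintype.card (⊤ : SimpleGraph (Fin n)).edgeSet + 1) ^ (v₀ - 1).choose 2 ∧
      (∀ T ∈ 𝓣, #T ≤ (v₀ - 1).choose 2 ∧ ∀ e ∈ T, ∀ v ∈ (e : Sym2 (Fin n)), v ∈ V₁) ∧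
      ∀ w : EdgeVec n, (∀ e : (⊤ : SimpleGraph (Fin n)).edgeSet, (¬ ∀ v ∈ (e : Sym2 (Fin n)), v ∈ V₁) → w e = x e) →
        ((∀ S ∈ l, ∃ e ∈ S, w e = true) ↔ ∃ T ∈ 𝓣, ∀ e ∈ T, w e = true) := by
  have hr : ∀ z : EdgeVec n, #(swRun V₁ x z l ∅).2 ≤ (v₀ - 1).choose 2 := by
    intro z
    refine (card_le_choose_two_of_inside (univ.filter fun v : Fin n =>
      ∃ e ∈ (swRun V₁ x z l ∅).2, v ∈ (e : Sym2 (Fin n))) _ fun e he v hv =>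
        mem_filter.2 ⟨mem_univ _, e, he, hv⟩).trans (Nat.choose_le_choose 2 ?_)
    have := hgood z
    omega
  obtain ⟨𝓣, hcard, hT, hiff⟩ := swRun_exists_dnf V₁ x l ((v₀ - 1).choose 2) hr
  refine ⟨𝓣, hcard, hT, fun w hw => ?_⟩
  rw [← hiff w, swRun_fst_eq_true_iff]
  refine forall₂_congr fun S _ => exists_congr fun e => and_congr_right fun _ => ?_
  by_cases he : ∀ v ∈ (e : Sym2 (Fin n)), v ∈ V₁
  · constructor
    · exact fun h => Or.inl ⟨he, h⟩
    · rintro (⟨-, h⟩ | ⟨hne, -⟩)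
      · exact h
      · exact absurd he hne
  · rw [hw e he]
    constructor
    · exact fun h => Or.inr ⟨he, h⟩
    · rintro (⟨h1, -⟩ | ⟨-, h⟩)
      · exact absurd h1 he
      · exact h

open Classical in
/-- **Dual form: on the good event (for the complemented input) the restricted DNF is an `r`-CNF.** If every canonical
run under `(V₁, ¬x)` queries slots meeting `< v₀` vertices, there is a family `𝓒` of `≤ (#slots+1)^r` clauses, each of
`≤ r` slots inside `V₁`, such that on every input agreeing with `x` off the inside of `V₁` the DNF of `l` holds iff every
clause of `𝓒` is hit (de Morgan through `switch_dnf_of_good`). [cite: Beame1994, §3] -/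
theorem switch_cnf_of_good (V₁ : Finset (Fin n)) (x : EdgeVec n) (l : List (Finset (⊤ : SimpleGraph (Fin n)).edgeSet))
    (v₀ : ℕ) (hgood : ∀ z : EdgeVec n, #(univ.filter fun v : Fin n =>
      ∃ e ∈ (swRun V₁ (fun e => !x e) z l ∅).2, v ∈ (e : Sym2 (Fin n))) < v₀) :
    ∃ 𝓒 : Finset (Finset (⊤ : SimpleGraph (Fin n)).edgeSet),
      #𝓒 ≤ (Fintype.card (⊤ : SimpleGraph (Fin n)).edgeSet + 1) ^ (v₀ - 1).choose 2 ∧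
      (∀ T ∈ 𝓒, #T ≤ (v₀ - 1).choose 2 ∧ ∀ e ∈ T, ∀ v ∈ (e : Sym2 (Fin n)), v ∈ V₁) ∧
      ∀ w : EdgeVec n, (∀ e : (⊤ : SimpleGraph (Fin n)).edgeSet, (¬ ∀ v ∈ (e : Sym2 (Fin n)), v ∈ V₁) → w e = x e) →
        ((∃ T ∈ l, ∀ e ∈ T, w e = true) ↔ ∀ S ∈ 𝓒, ∃ e ∈ S, w e = true) := by
  obtain ⟨𝓣, hcard, hT, hiff⟩ := switch_dnf_of_good V₁ (fun e => !x e) l v₀ hgood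
  refine ⟨𝓣, hcard, hT, fun w hw => ?_⟩
  have h := hiff (fun e => !w e) fun e he => by simp [hw e he]
  simp only [Bool.not_eq_true'] at h
  -- `DNF_l(w) = ¬ CNF_l(¬w)` and `(∃ T ∈ 𝓣, T white in w) = ¬ (∀ T ∈ 𝓣, T hit by w)`
  constructor
  · rintro ⟨T, hTl, hTw⟩ S hS
    by_contra hno
    have hno' : ∀ e ∈ S, w e = false := by
      intro e he
      cases hwe : w e
      · rfl
      · exact absurd ⟨e, he, hwe⟩ hno
    obtain ⟨e, heT, hwe⟩ := (h.2 ⟨S, hS, hno'⟩) T hTl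
    rw [hTw e heT] at hwe
    cases hwe
  · intro hall
    by_contra hno
    have hcnf : ∀ S ∈ l, ∃ e ∈ S, w e = false := by
      intro S hS
      by_contra hS'
      refine hno ⟨S, hS, fun e he => ?_⟩
      cases hwe : w e
      · exact absurd ⟨e, he, hwe⟩ hS'
      · rfl
    obtain ⟨T, hT𝓣, hTw⟩ := h.1 hcnf
    obtain ⟨e, heT, hwe⟩ := hall T hT𝓣
    rw [hTw e heT] at hwe
    cases hwe

/-- Complementing the input does not change the count of the bad event. [folklore] -/
theorem switch_bad_count_compl (V₁ : Finset (Fin n)) (l : List (Finset (⊤ : SimpleGraph (Fin n)).edgeSet)) (v₀ : ℕ) :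
    #(univ.filter fun x : EdgeVec n => ∃ z : EdgeVec n, v₀ ≤ #(univ.filter fun v : Fin n =>
        ∃ e ∈ (swRun V₁ (fun e => !x e) z l ∅).2, v ∈ (e : Sym2 (Fin n)))) =
      #(univ.filter fun x : EdgeVec n => ∃ z : EdgeVec n, v₀ ≤ #(univ.filter fun v : Fin n =>
        ∃ e ∈ (swRun V₁ x z l ∅).2, v ∈ (e : Sym2 (Fin n)))) := by
  classical
  refine card_bij (fun x _ => fun e => !x e) (fun x hx => ?_) (fun x _ x' _ h => ?_) (fun y hy => ?_)
  · rw [mem_filter] at hx ⊢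
    exact ⟨mem_univ _, hx.2⟩
  · funext e
    have := congr_fun h e
    simpa using this
  · refine ⟨fun e => !y e, ?_, ?_⟩
    · rw [mem_filter] at hy ⊢
      refine ⟨mem_univ _, ?_⟩
      simpa using hy.2
    · funext e; simp

/-- Registered stub `stub_switch` of the clique-restriction switching line (the vertex-structure count). [folklore] -/
theorem stub_switch :
    ∀ (n n₁ L v₀ : ℕ) (V : Finset (Fin n)) (l : List (Finset ((⊤ : SimpleGraph (Fin n)).edgeSet))),
      (∀ S ∈ l, S.card ≤ L) →
        ((Finset.powersetCard n₁ V).filter fun V₁ => ∃ S ∈ l,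
          v₀ ≤ ((Finset.univ.filter fun v : Fin n => ∃ e ∈ S, v ∈ (e : Sym2 (Fin n))) ∩ V₁).card).card ≤
        l.length * ((2 * L).choose v₀ * (V.card - v₀).choose (n₁ - v₀)) :=
  fun _ n₁ L v₀ V l hl => switch_vertexBad_card_le V n₁ L v₀ l hl

end Summit.PneNP.PneNP.Theorems
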